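import Summits.Ventures.HodgeRepro2.BallQuotientMeasure

/-!
# A compact quotient `Γ\𝔹²` has finite Bergman covolume

Kernel support for the blind cell pub-hodge-repro2 (seat p2), T5-ID §ID-4(b′).  The quotient measure of
`BallQuotientMeasure.lean` is finite iff the fundamental domain has finite Bergman measure; here that
finiteness is PROVED from the compactness of `Γ\𝔹²`: every point of the ball has an open neighbourhood
`{‖w‖² < c}` (`c < 1`) of finite Bergman measure (the density is bounded by `(1 − c)^{-3}` there and
the ball has finite Lebesgue measure), the images of such neighbourhoods cover the compact quotient, a
finite subcover exists, and `μ_S (mk '' V) ≤ μ_B (V)` (countable subadditivity + `S`-invariance +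
`IsFundamentalDomain.measure_eq_tsum'`).  Consequently Mathlib's `covolume S 𝔹² μ_B` is finite.
-/

namespace Summit.Ventures.HodgeRepro2.ShimuraData

open MeasureTheory
open scoped Pointwise

/-- The ball lies in the unit ball of the sup norm. -/
theorem ball₂_subset_metric_ball : ball₂ ⊆ Metric.ball (0 : Fin 2 → ℂ) 1 := by
  intro z hz
  rw [Metric.mem_ball, dist_zero_right, pi_norm_lt_iff one_pos]
  intro i
  have hsum : ∑ k, ‖z k‖ ^ 2 < 1 := hz
  have hi : ‖z i‖ ^ 2 ≤ ∑ k, ‖z k‖ ^ 2 :=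
    Finset.single_le_sum (fun k _ => sq_nonneg ‖z k‖) (Finset.mem_univ i)
  nlinarith [norm_nonneg (z i)]

/-- The ball has finite Lebesgue measure. -/
theorem volume_ball₂_lt_top : volume ball₂ < ⊤ :=
  lt_of_le_of_lt (measure_mono ball₂_subset_metric_ball) measure_ball_lt_top

/-- On `{‖z‖² < c}` (`c < 1`) the volume density is bounded by `(1 − c)^{-3}`. -/
theorem volumeDensity_le_of_normSq₂_lt {c : ℝ} (hc : c < 1) {z : Fin 2 → ℂ} (hz : normSq₂ z < c) :
    volumeDensity z ≤ ((1 - c) ^ 3)⁻¹ := by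
  unfold volumeDensity
  have h1 : 0 < 1 - c := sub_pos.mpr hc
  have h2 : 1 - c ≤ 1 - normSq₂ z := by linarith
  exact inv_anti₀ (by positivity) (pow_le_pow_left₀ h1.le h2 3)

/-- The shrunken balls `{‖z‖² < c}`, `c < 1`, have finite Bergman measure. -/
theorem bergmanMeasure_setOf_normSq₂_lt_lt_top {c : ℝ} (hc : c < 1) :
    bergmanMeasure {z | normSq₂ z < c} < ⊤ := by
  have hmeas : MeasurableSet {z : Fin 2 → ℂ | normSq₂ z < c} :=
    (isOpen_lt (by unfold normSq₂; fun_prop) continuous_const).measurableSet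
  unfold bergmanMeasure
  rw [withDensity_apply _ hmeas, Measure.restrict_restrict hmeas]
  calc ∫⁻ z in {z | normSq₂ z < c} ∩ ball₂, ENNReal.ofReal (volumeDensity z)
      ≤ ∫⁻ _ in {z | normSq₂ z < c} ∩ ball₂, ENNReal.ofReal (((1 - c) ^ 3)⁻¹) :=
        setLIntegral_mono' (hmeas.inter measurableSet_ball₂) fun z hz =>
          ENNReal.ofReal_le_ofReal (volumeDensity_le_of_normSq₂_lt hc hz.1)
    _ = ENNReal.ofReal (((1 - c) ^ 3)⁻¹) * volume ({z | normSq₂ z < c} ∩ ball₂) :=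
        setLIntegral_const _ _
    _ < ⊤ := ENNReal.mul_lt_top ENNReal.ofReal_lt_top
        (lt_of_le_of_lt (measure_mono Set.inter_subset_right) volume_ball₂_lt_top)

/-- Every point of `𝔹²` has an open neighbourhood of finite Bergman measure. -/
theorem exists_isOpen_mem_bergmanBall_lt_top (z : ball₂) :
    ∃ V : Set ball₂, IsOpen V ∧ z ∈ V ∧ bergmanBall V < ⊤ := by
  set c : ℝ := (1 + normSq₂ (z : Fin 2 → ℂ)) / 2 with hc
  have hz1 : normSq₂ (z : Fin 2 → ℂ) < 1 := normSq₂_lt_one z.property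
  have hc1 : c < 1 := by rw [hc]; linarith
  have hzc : normSq₂ (z : Fin 2 → ℂ) < c := by rw [hc]; linarith
  refine ⟨Subtype.val ⁻¹' {w | normSq₂ w < c}, ?_, hzc, ?_⟩
  · exact (isOpen_lt (by unfold normSq₂; fun_prop) continuous_const).preimage continuous_subtype_val
  · rw [bergmanBall_apply]
    exact lt_of_le_of_lt (measure_mono (Set.image_preimage_subset _ _))
      (bergmanMeasure_setOf_normSq₂_lt_lt_top hc1)

section FrameAction

variable {K : Type*} [Field K] [NumberField K] [NumberField.IsCMField K]
    {τ₁ : K →+* ℂ} {H : Matrix (Fin 3) (Fin 3) K} {Q : Matrix (Fin 3) (Fin 3) ℂ}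
    (hQ : IsFrame K τ₁ H Q) (S : Subgroup (GL (Fin 3) K)) (hS : (S : Set (GL (Fin 3) K)) ⊆ unitaryGroup K H)

/-- The preimage of the image of `V` is the union of the translates of `V`. -/
theorem preimage_mk_image_mk (V : Set ball₂) :
    letI := frameAction hQ S hS
    ballQuotient.mk hQ S hS ⁻¹' (ballQuotient.mk hQ S hS '' V) = ⋃ γ : S, γ • V := by
  letI := frameAction hQ S hS
  ext z
  simp only [Set.mem_preimage, Set.mem_image, Set.mem_iUnion, Set.mem_smul_set]
  constructor
  · rintro ⟨v, hv, hmk⟩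
    obtain ⟨γ, hγ⟩ := (ballQuotient_mk_eq_mk_iff hQ S hS v z).mp hmk
    have hγ' : γ • z = v := Subtype.ext (by rw [frameAction_smul_coe]; exact hγ)
    exact ⟨γ⁻¹, v, hv, by rw [← hγ', inv_smul_smul]⟩
  · rintro ⟨γ, v, hv, rfl⟩
    refine ⟨v, hv, (ballQuotient_mk_eq_mk_iff hQ S hS v (γ • v)).mpr ⟨γ⁻¹, ?_⟩⟩
    rw [← frameAction_smul_coe hQ S hS γ⁻¹ (γ • v), inv_smul_smul]

/-- The image of a measurable set under `mk` is measurable. -/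
theorem measurableSet_image_mk {V : Set ball₂} (hV : MeasurableSet V) :
    MeasurableSet (ballQuotient.mk hQ S hS '' V) := by
  letI := frameAction hQ S hS
  haveI : MeasurableConstSMul S ball₂ := measurableConstSMul_frameAction hQ S hS
  haveI : Countable S := countable_subgroup_GL_of_numberField S
  refine (measurableSet_quotient (s := MulAction.orbitRel S ball₂)).mpr ?_
  show MeasurableSet (ballQuotient.mk hQ S hS ⁻¹' (ballQuotient.mk hQ S hS '' V))
  rw [preimage_mk_image_mk]
  exact MeasurableSet.iUnion fun γ => hV.const_smul γ

/-- **The key estimate**: `μ_S (mk '' V) ≤ μ_B (V)` for a fundamental domain `D` and measurable `V`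
(countable subadditivity, `S`-invariance, and `μ_B V = ∑' γ, μ_B (V ∩ γ • D)`). -/
theorem quotientMeasure_image_mk_le {D : Set ball₂} (hD : IsBallFundamentalDomain hQ S hS D)
    {V : Set ball₂} (hV : MeasurableSet V) :
    quotientMeasure hQ S hS D (ballQuotient.mk hQ S hS '' V) ≤ bergmanBall V := by
  letI := frameAction hQ S hS
  haveI : MeasurableConstSMul S ball₂ := measurableConstSMul_frameAction hQ S hS
  haveI : SMulInvariantMeasure S ball₂ bergmanBall := smulInvariantMeasure_bergmanBall hQ S hS
  haveI : Countable S := countable_subgroup_GL_of_numberField S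
  rw [quotientMeasure_apply hQ S hS D (measurableSet_image_mk hQ S hS hV), preimage_mk_image_mk,
    Set.iUnion_inter]
  calc bergmanBall (⋃ γ : S, γ • V ∩ D) ≤ ∑' γ : S, bergmanBall (γ • V ∩ D) := measure_iUnion_le _
    _ = ∑' γ : S, bergmanBall (V ∩ γ⁻¹ • D) := by
        refine tsum_congr fun γ => ?_
        rw [← measure_smul bergmanBall γ (V ∩ γ⁻¹ • D), Set.smul_set_inter, smul_inv_smul]
    _ = ∑' γ : S, bergmanBall (V ∩ γ • D) :=
        (Equiv.inv S).tsum_eq fun γ => bergmanBall (V ∩ γ • D)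
    _ = bergmanBall V := (hD.measure_eq_tsum' V).symm

/-- **A compact quotient has a fundamental domain of finite Bergman measure.** -/
theorem bergmanBall_lt_top_of_compactSpace [CompactSpace (ballQuotient hQ S hS)] {D : Set ball₂}
    (hD : IsBallFundamentalDomain hQ S hS D) : bergmanBall D < ⊤ := by
  choose V hVo hVz hVfin using exists_isOpen_mem_bergmanBall_lt_top
  have hcov : (Set.univ : Set (ballQuotient hQ S hS)) ⊆ ⋃ z, ballQuotient.mk hQ S hS '' V z := by
    intro x _
    obtain ⟨z, rfl⟩ := ballQuotient_mk_surjective hQ S hS x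
    exact Set.mem_iUnion.mpr ⟨z, z, hVz z, rfl⟩
  obtain ⟨T, hT⟩ := isCompact_univ.elim_finite_subcover _
    (fun z => (isOpenQuotientMap_ballQuotient_mk hQ S hS).isOpenMap _ (hVo z)) hcov
  have h1 : quotientMeasure hQ S hS D Set.univ ≤
      ∑ z ∈ T, quotientMeasure hQ S hS D (ballQuotient.mk hQ S hS '' V z) :=
    (measure_mono hT).trans (measure_biUnion_finset_le T _)
  rw [quotientMeasure_univ] at h1
  refine lt_of_le_of_lt h1 (ENNReal.sum_lt_top.mpr fun z _ => ?_)
  exact lt_of_le_of_lt (quotientMeasure_image_mk_le hQ S hS hD (hVo z).measurableSet) (hVfin z)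

/-- Mathlib's `covolume` of the frame action is finite for a compact quotient. -/
theorem covolume_lt_top_of_compactSpace [CompactSpace (ballQuotient hQ S hS)] {D : Set ball₂}
    (hD : IsBallFundamentalDomain hQ S hS D) :
    letI := frameAction hQ S hS
    covolume S ball₂ bergmanBall < ⊤ := by
  letI := frameAction hQ S hS
  haveI : MeasurableConstSMul S ball₂ := measurableConstSMul_frameAction hQ S hS
  haveI : SMulInvariantMeasure S ball₂ bergmanBall := smulInvariantMeasure_bergmanBall hQ S hS
  haveI : Countable S := countable_subgroup_GL_of_numberField S
  rw [hD.covolume_eq_volume]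
  exact bergmanBall_lt_top_of_compactSpace hQ S hS hD

/-- The quotient measure of a compact quotient is finite. -/
theorem isFiniteMeasure_quotientMeasure_of_compactSpace [CompactSpace (ballQuotient hQ S hS)]
    {D : Set ball₂} (hD : IsBallFundamentalDomain hQ S hS D) :
    IsFiniteMeasure (quotientMeasure hQ S hS D) :=
  isFiniteMeasure_quotientMeasure hQ S hS D (bergmanBall_lt_top_of_compactSpace hQ S hS hD)

end FrameAction

end Summit.Ventures.HodgeRepro2.ShimuraData
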